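import Literature.NumberTheory.ModularSymbols.CuspidalHomologyShiftNorm
import HarnessLib

/-!
# The Hilbert-90 defect `Λ_P/Λ₁ = H¹(⟨t⟩, H₁(X₀(N), ℤ))` realised on the Jacobian: the map
# `Λ_P → J₀(N)(ℂ)^t`, `y ↦ [(y − t y)/3]`, with kernel `Λ₁` modulo `B = Nm J₀(N)` and image all of `J^t/B`

Sequel of `CuspidalHomologyShiftNorm` (p661679 · p662714) for the crux `TprimeIrrModThreeSaturation`
(stmt-BirchSwinnertonDyer-23367), stub H2 = `TprimeIrrPrymDefectAvoidsThree` (stmt-BirchSwinnertonDyer-23480) of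
LINE 29 / line `abelian-fixed-points` (lead `cruxlead-stmt-BirchSwinnertonDyer-23367`). Everything is PROVED; no
named facts, no instances, no notation, no Galois action.

Notation: `V = S₂(Γ₀(N))^∨`, `Λ = periodHomologyHecke N`, `J0 N = V/Λ`, `t = shiftDual / shiftInt / J0.shift`
(`9 ∣ N`), `Nm = 1 + t + t²` (`normDual`, `normInt`, `jacobianNorm`), `B = normRange = Nm J₀(N)`,
`Λ_P = prymLattice = ker Nm`, `Λ₁ = shiftSubOneLattice = (t − 1)Λ`, `J^t = {z : t z = z}`.

* `prymDefectMap N h9 : Λ_P →+ J0 N`, `y ↦ [3⁻¹(y − t y)]`: values are `t`-fixed (`shift_prymDefectMap`) and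
  `3`-torsion (`three_nsmul_prymDefectMap`, `prymDefectMap_mem_tors`);
* **kernel modulo `B`**: `prymDefectMap y ∈ B ↔ y ∈ Λ₁` (`prymDefectMap_mem_normRange_iff`);
* **onto `J^t` modulo `B`**: every `t`-fixed `z` is `prymDefectMap y + Nm z'` (`exists_prymDefectMap_add_eq`);
  so `Λ_P/Λ₁ ≅ J₀(N)^t/B` (the group `π₀(J^t)`, of order `3^{r−2}`, `r = #Fix t`);
* Hecke: `δ(T_p y) = T_p δ(y)` for `p ≡ 1 (mod 3)` and `δ(T_p y) = 2·T_p δ(y) = −T_p δ(y)` for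
  `p ≡ 2 (mod 3)` (`prymDefectMap_T_smul_of_mod_three_eq_one/two`): the `χ₋₃`-twist;
* `B ∩ J_tors = Nm(J_tors)` (`exists_mem_tors_jacobianNorm_eq`).

These are the lattice-side half of the dictionary by which H2 becomes «`Γ_ℚ` acts on `J^t/B` through the
abelian group `Gal(ℚ(ζ_N)/ℚ)` (fixed points of `t` are cusps and `j = 0` points, rational over `ℚ(ζ_N)`),
so Boston–Lenstra–Ribet leaves no irreducible `ρ̄` there»; the Galois half is NOT here.

## References

* M. Harrison, the `X₀(108)` shift computations, 2011, §2 (the shift `t`, `Nm = π^*π_*`).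
* H. Darmon, F. Diamond, R. Taylor, *Fermat's Last Theorem*, 1995, §1.3 pp. 27–32 (`J = V/Λ`, `J[n] = n⁻¹Λ/Λ`).
* D. Mumford, *Prym varieties I*, 1974, §3 (invariant classes of a cyclic cover: pull-backs and fixed points).
-/

noncomputable section

open scoped MatrixGroups ModularForm

open CongruenceSubgroup
open Literature.NumberTheory.EllipticCurves.ModularForms

namespace Literature.NumberTheory.ModularSymbols

section PrymDefect

variable (N : ℕ) [NeZero N] (h9 : 3 ^ 2 ∣ N)

/-- `(1 − t)²φ = Nm φ − 3·tφ` on `V`. [cite: Harrison2011X0108, §2] -/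
theorem sub_shiftDual_sub_shiftDual (φ : Module.Dual ℂ (CuspForm (Gamma0 N) 2)) :
    (φ - shiftDual N h9 φ) - shiftDual N h9 (φ - shiftDual N h9 φ) =
      normDual N h9 φ - (3 : ℂ) • shiftDual N h9 φ := by
  rw [normDual_apply, map_sub]
  module

/-- **The Hilbert-90 defect map `δ : Λ_P → J₀(N)(ℂ)`, `y ↦ [3⁻¹(y − t y)]`** (equivalently `[(t − 1)⁻¹ y]`:
`(t − 1)·3⁻¹(y − t y) = t y ≡ 0`, since `(1 − t)² = −3t` on `ker Nm`). [cite: DarmonDiamondTaylor1995, §1.3 (p. 27)] -/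
def prymDefectMap : prymLattice N h9 →+ J0 N where
  toFun y := Submodule.Quotient.mk
    ((3 : ℂ)⁻¹ • (((y : periodHomologyHecke N) : Module.Dual ℂ (CuspForm (Gamma0 N) 2)) -
      shiftDual N h9 ((y : periodHomologyHecke N) : Module.Dual ℂ (CuspForm (Gamma0 N) 2))))
  map_zero' := by simp
  map_add' x y := by
    simp only [Submodule.coe_add, map_add, smul_add, add_sub_add_comm, Submodule.Quotient.mk_add]

/-- Unfolding `prymDefectMap`. [cite: DarmonDiamondTaylor1995, §1.3 (p. 27)] -/
theorem prymDefectMap_apply (y : prymLattice N h9) :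
    prymDefectMap N h9 y = Submodule.Quotient.mk
      ((3 : ℂ)⁻¹ • (((y : periodHomologyHecke N) : Module.Dual ℂ (CuspForm (Gamma0 N) 2)) -
        shiftDual N h9 ((y : periodHomologyHecke N) : Module.Dual ℂ (CuspForm (Gamma0 N) 2)))) :=
  rfl

/-- `Nm y = 0` in `V` for `y ∈ Λ_P`. [cite: Harrison2011X0108, §2] -/
theorem normDual_coe_eq_zero (y : prymLattice N h9) :
    normDual N h9 (((y : periodHomologyHecke N) : Module.Dual ℂ (CuspForm (Gamma0 N) 2))) = 0 := by
  rw [← coe_normInt_apply, (mem_prymLattice_iff N h9 _).mp y.2, Submodule.coe_zero]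

/-- **`3·δ(y) = [y − t y] = 0`**: `δ` lands in `J₀(N)[3]`. [cite: DarmonDiamondTaylor1995, §1.3 (p. 27)] -/
theorem three_nsmul_prymDefectMap (y : prymLattice N h9) : 3 • prymDefectMap N h9 y = 0 := by
  have h3 : (3 : ℕ) • ((3 : ℂ)⁻¹ • (((y : periodHomologyHecke N) : Module.Dual ℂ (CuspForm (Gamma0 N) 2)) -
      shiftDual N h9 ((y : periodHomologyHecke N) : Module.Dual ℂ (CuspForm (Gamma0 N) 2)))) =
      ((y : periodHomologyHecke N) : Module.Dual ℂ (CuspForm (Gamma0 N) 2)) -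
        shiftDual N h9 ((y : periodHomologyHecke N) : Module.Dual ℂ (CuspForm (Gamma0 N) 2)) := by
    rw [← Nat.cast_smul_eq_nsmul ℂ, smul_smul]
    norm_num
  rw [prymDefectMap_apply, ← Submodule.mkQ_apply, ← map_nsmul, h3, Submodule.mkQ_apply,
    Submodule.Quotient.mk_eq_zero, ← coe_shiftInt, ← Submodule.coe_sub]
  exact Submodule.coe_mem _

/-- **`δ(y)` is `t`-fixed**: `t·3⁻¹(y − t y) − 3⁻¹(y − t y) = −3⁻¹(1 − t)²y = t y − 3⁻¹Nm y = t y ∈ Λ`.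
[cite: DarmonDiamondTaylor1995, §1.3 (p. 32)] -/
theorem shift_prymDefectMap (y : prymLattice N h9) :
    J0.shift N h9 (prymDefectMap N h9 y) = prymDefectMap N h9 y := by
  rw [prymDefectMap_apply, J0.shift_mk, eq_comm, ← sub_eq_zero, ← Submodule.Quotient.mk_sub,
    Submodule.Quotient.mk_eq_zero, map_smul, ← smul_sub, sub_shiftDual_sub_shiftDual, normDual_coe_eq_zero,
    zero_sub, smul_neg, smul_smul, inv_mul_cancel₀ (by norm_num : (3 : ℂ) ≠ 0), one_smul, ← coe_shiftInt]
  exact neg_mem (Submodule.coe_mem _)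

/-- `δ(y)` is a torsion point of `J₀(N)(ℂ)`. [cite: DarmonDiamondTaylor1995, §1.3 (p. 27)] -/
theorem prymDefectMap_mem_tors (y : prymLattice N h9) : prymDefectMap N h9 y ∈ J0.tors N := by
  rw [J0.mem_tors_iff]
  exact isOfFinAddOrder_iff_nsmul_eq_zero.mpr ⟨3, by norm_num, three_nsmul_prymDefectMap N h9 y⟩

/-- `δ(y)`, as a torsion point, lies in the `t`-fixed torsion `J₀(N)_tors^t`. [cite: DarmonDiamondTaylor1995, §1.3 (p. 32)] -/
theorem prymDefectMap_mem_torsFixedByShift (y : prymLattice N h9) :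
    (⟨prymDefectMap N h9 y, prymDefectMap_mem_tors N h9 y⟩ : J0.tors N) ∈ J0.torsFixedByShift N h9 := by
  rw [J0.mem_torsFixedByShift_iff]
  apply Subtype.ext
  rw [J0.coe_shiftTors]
  exact shift_prymDefectMap N h9 y

/-- `[φ] ∈ B` for every `φ` in the `t`-fixed subspace `V_B = Nm V` — in particular `[3⁻¹ Nm ψ] ∈ B`:
`[3⁻¹Nm ψ] = Nm[9⁻¹ Nm ψ]`... concretely `[c • Nm ψ] = Nm [c • ψ]`. [cite: DarmonDiamondTaylor1995, §1.3 (p. 32)] -/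
theorem mk_smul_normDual_mem_normRange (c : ℂ) (ψ : Module.Dual ℂ (CuspForm (Gamma0 N) 2)) :
    (Submodule.Quotient.mk (p := periodHomologyHecke N) (c • normDual N h9 ψ) : J0 N) ∈ normRange N h9 := by
  refine ⟨Submodule.Quotient.mk (c • ψ), ?_⟩
  rw [jacobianNorm_mk, map_smul]

/-- **Kernel modulo `B`, easy half**: for `y = t λ − λ ∈ Λ₁`, `δ(y) = −[3⁻¹ Nm λ] ∈ B`.
[cite: DarmonDiamondTaylor1995, §1.3 (p. 32)] -/
theorem prymDefectMap_mem_normRange_of_mem {y : prymLattice N h9}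
    (hy : (y : periodHomologyHecke N) ∈ shiftSubOneLattice N h9) : prymDefectMap N h9 y ∈ normRange N h9 := by
  obtain ⟨w, hw⟩ := (mem_shiftSubOneLattice_iff N h9 _).mp hy
  have hcoe : ((y : periodHomologyHecke N) : Module.Dual ℂ (CuspForm (Gamma0 N) 2)) =
      shiftDual N h9 (w : Module.Dual ℂ (CuspForm (Gamma0 N) 2)) - w := by
    rw [← hw, Submodule.coe_sub, coe_shiftInt]
  -- `3⁻¹(y − t y) = 3⁻¹(3 t w − Nm w) = t w − 3⁻¹ Nm w`
  have hval : (3 : ℂ)⁻¹ • (((y : periodHomologyHecke N) : Module.Dual ℂ (CuspForm (Gamma0 N) 2)) -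
      shiftDual N h9 ((y : periodHomologyHecke N) : Module.Dual ℂ (CuspForm (Gamma0 N) 2))) =
      shiftDual N h9 (w : Module.Dual ℂ (CuspForm (Gamma0 N) 2)) +
        (-(3 : ℂ)⁻¹) • normDual N h9 (w : Module.Dual ℂ (CuspForm (Gamma0 N) 2)) := by
    rw [hcoe]
    simp only [map_sub, normDual_apply]
    module
  rw [prymDefectMap_apply, hval, Submodule.Quotient.mk_add]
  refine AddSubgroup.add_mem _ ?_ (mk_smul_normDual_mem_normRange N h9 _ _)
  rw [← coe_shiftInt, (Submodule.Quotient.mk_eq_zero _).mpr (Submodule.coe_mem _)]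
  exact AddSubgroup.zero_mem _

/-- **Kernel modulo `B`, hard half**: if `δ(y) ∈ B` then `y ∈ Λ₁` (`3⁻¹(y − ty) − Nm v = λ ∈ Λ`; apply
`t − 1`: the left side becomes `t y`, so `t y = tλ − λ ∈ Λ₁` and `y = t²(t y) ∈ Λ₁`).
[cite: DarmonDiamondTaylor1995, §1.3 (p. 32)] -/
theorem mem_of_prymDefectMap_mem_normRange {y : prymLattice N h9}
    (hy : prymDefectMap N h9 y ∈ normRange N h9) : (y : periodHomologyHecke N) ∈ shiftSubOneLattice N h9 := by
  obtain ⟨z, hz⟩ := hy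
  obtain ⟨v, rfl⟩ := Submodule.Quotient.mk_surjective (periodHomologyHecke N) z
  rw [jacobianNorm_mk, prymDefectMap_apply, Submodule.Quotient.eq] at hz
  -- `λ := Nm v − 3⁻¹(y − t y) ∈ Λ`
  set yV : Module.Dual ℂ (CuspForm (Gamma0 N) 2) :=
    ((y : periodHomologyHecke N) : Module.Dual ℂ (CuspForm (Gamma0 N) 2)) with hyV
  have key : shiftDual N h9 (normDual N h9 v - (3 : ℂ)⁻¹ • (yV - shiftDual N h9 yV)) -
      (normDual N h9 v - (3 : ℂ)⁻¹ • (yV - shiftDual N h9 yV)) = -shiftDual N h9 yV := by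
    have hNm : shiftDual N h9 (normDual N h9 v) = normDual N h9 v := by
      rw [← Module.End.mul_apply, shiftDual_mul_normDual]
    -- `t t yV = −yV − t yV` (`Nm yV = 0`)
    have htt : shiftDual N h9 (shiftDual N h9 yV) = -yV - shiftDual N h9 yV := by
      have h0 := normDual_coe_eq_zero N h9 y
      rw [normDual_apply] at h0
      rw [← sub_eq_zero]
      rw [← h0]
      abel
    simp only [map_sub, map_smul, hNm, htt]
    module
  -- `t y = −(tλ − λ) ∈ Λ₁`
  have hty : shiftInt N h9 (y : periodHomologyHecke N) ∈ shiftSubOneLattice N h9 := by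
    have hmem : shiftInt N h9 ⟨_, hz⟩ - ⟨_, hz⟩ ∈ shiftSubOneLattice N h9 :=
      shiftInt_sub_mem_shiftSubOneLattice N h9 _
    have hcoe : ((shiftInt N h9 ⟨_, hz⟩ - ⟨_, hz⟩ : periodHomologyHecke N) :
        Module.Dual ℂ (CuspForm (Gamma0 N) 2)) = -shiftDual N h9 yV := by
      rw [Submodule.coe_sub, coe_shiftInt]
      exact key
    have hneg : shiftInt N h9 (y : periodHomologyHecke N) = -(shiftInt N h9 ⟨_, hz⟩ - ⟨_, hz⟩) := by
      apply Subtype.ext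
      rw [Submodule.coe_neg, hcoe, neg_neg, coe_shiftInt]
    rw [hneg]
    exact neg_mem hmem
  have h3 := shiftInt_mem_shiftSubOneLattice N h9 (shiftInt_mem_shiftSubOneLattice N h9 hty)
  rwa [shiftInt_shiftInt_shiftInt] at h3

/-- **`δ(y) ∈ B ↔ y ∈ Λ₁`**: `δ` induces an injection `Λ_P/Λ₁ ↪ J₀(N)^t/B`. [cite: DarmonDiamondTaylor1995, §1.3 (p. 32)] -/
theorem prymDefectMap_mem_normRange_iff (y : prymLattice N h9) :
    prymDefectMap N h9 y ∈ normRange N h9 ↔ (y : periodHomologyHecke N) ∈ shiftSubOneLattice N h9 :=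
  ⟨mem_of_prymDefectMap_mem_normRange N h9, prymDefectMap_mem_normRange_of_mem N h9⟩

/-- **Onto `J^t/B`**: a `t`-fixed `z = [v]` has `y := t v − v ∈ Λ_P` and `z = δ(y) + Nm[3⁻¹ v]`
(`δ(y) = [−3⁻¹(1 − t)²v] = [t v] − [3⁻¹ Nm v]`). [cite: DarmonDiamondTaylor1995, §1.3 (p. 32)] -/
theorem exists_prymDefectMap_add_eq {z : J0 N} (hz : J0.shift N h9 z = z) :
    ∃ (y : prymLattice N h9) (z' : J0 N), prymDefectMap N h9 y + jacobianNorm N h9 z' = z := by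
  obtain ⟨v, rfl⟩ := Submodule.Quotient.mk_surjective (periodHomologyHecke N) z
  rw [J0.shift_mk, Submodule.Quotient.eq] at hz
  have hP : (⟨_, hz⟩ : periodHomologyHecke N) ∈ prymLattice N h9 := by
    rw [mem_prymLattice_iff]
    apply Subtype.ext
    rw [coe_normInt_apply, Submodule.coe_zero, map_sub, ← Module.End.mul_apply, normDual_mul_shiftDual, sub_self]
  refine ⟨⟨_, hP⟩, Submodule.Quotient.mk ((3 : ℂ)⁻¹ • v), ?_⟩
  rw [prymDefectMap_apply, jacobianNorm_mk, ← Submodule.Quotient.mk_add, Submodule.Quotient.eq]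
  have e : (3 : ℂ)⁻¹ • ((shiftDual N h9 v - v) - shiftDual N h9 (shiftDual N h9 v - v)) +
      normDual N h9 ((3 : ℂ)⁻¹ • v) - v = shiftDual N h9 v - v := by
    simp only [map_sub, map_smul, normDual_apply]
    module
  change (3 : ℂ)⁻¹ • ((((⟨_, hz⟩ : periodHomologyHecke N) : periodHomologyHecke N) :
      Module.Dual ℂ (CuspForm (Gamma0 N) 2)) - shiftDual N h9 _) + normDual N h9 ((3 : ℂ)⁻¹ • v) - v ∈
    periodHomologyHecke N
  rw [e]
  exact hz

variable {N} in
/-- **Hecke law, `p ≡ 1 (mod 3)`**: `δ(T_p y) = T_p δ(y)`. [cite: DiamondShurman2005, Prop. 5.2.2(a) (derived reading, see `shiftInt_smul_T_of_mod_three_eq_one`)] -/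
theorem prymDefectMap_T_smul_of_mod_three_eq_one {p : ℕ} (hp : p.Prime) (hp3 : p ≠ 3) (hp1 : p % 3 = 1)
    (y : prymLattice N h9) :
    prymDefectMap N h9 ⟨HeckeRing0.T N 2 p hp • (y : periodHomologyHecke N), T_smul_mem_prymLattice h9 hp hp3 y.2⟩ =
      HeckeRing0.T N 2 p hp • prymDefectMap N h9 y := by
  haveI : NeZero p := ⟨hp.ne_zero⟩
  set yV : Module.Dual ℂ (CuspForm (Gamma0 N) 2) :=
    ((y : periodHomologyHecke N) : Module.Dual ℂ (CuspForm (Gamma0 N) 2)) with hyV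
  have hT : ((HeckeRing0.T N 2 p hp • (y : periodHomologyHecke N) : periodHomologyHecke N) :
      Module.Dual ℂ (CuspForm (Gamma0 N) 2)) = HeckeRing0.T N 2 p hp • yV := rfl
  have htT : shiftDual N h9 (HeckeRing0.T N 2 p hp • yV) = HeckeRing0.T N 2 p hp • shiftDual N h9 yV := by
    change shiftDual N h9 ((HeckeRing0.toEnd N 2 (HeckeRing0.T N 2 p hp)).dualMap yV) =
      (HeckeRing0.toEnd N 2 (HeckeRing0.T N 2 p hp)).dualMap (shiftDual N h9 yV)
    rw [HeckeRing0.toEnd_T, shiftDual_dualMap_heckeT_of_mod_three_eq_one h9 hp hp1]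
  have hlin : ∀ (c : ℂ) (φ ψ : Module.Dual ℂ (CuspForm (Gamma0 N) 2)),
      HeckeRing0.T N 2 p hp • (c • (φ - ψ)) = c • (HeckeRing0.T N 2 p hp • φ - HeckeRing0.T N 2 p hp • ψ) := by
    intro c φ ψ
    change (HeckeRing0.toEnd N 2 (HeckeRing0.T N 2 p hp)).dualMap (c • (φ - ψ)) =
      c • ((HeckeRing0.toEnd N 2 (HeckeRing0.T N 2 p hp)).dualMap φ -
        (HeckeRing0.toEnd N 2 (HeckeRing0.T N 2 p hp)).dualMap ψ)
    rw [map_smul, map_sub]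
  rw [prymDefectMap_apply, prymDefectMap_apply, ← Submodule.Quotient.mk_smul, hlin, ← htT]
  rfl

variable {N} in
/-- **Hecke law, `p ≡ 2 (mod 3)`: `δ(T_p y) = 2·T_p δ(y)` (`= −T_p δ(y)`, the `χ₋₃`-twist)**:
`3⁻¹ T_p(y − t²y) − 2·3⁻¹ T_p(y − t y) = −3⁻¹ T_p (1 − t)² y = T_p(t y) ∈ Λ`.
[cite: DiamondShurman2005, Prop. 5.2.2(a) (derived reading, see `shiftInt_smul_T_of_mod_three_eq_two`)] -/
theorem prymDefectMap_T_smul_of_mod_three_eq_two {p : ℕ} (hp : p.Prime) (hp3 : p ≠ 3) (hp2 : p % 3 = 2)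
    (y : prymLattice N h9) :
    prymDefectMap N h9 ⟨HeckeRing0.T N 2 p hp • (y : periodHomologyHecke N), T_smul_mem_prymLattice h9 hp hp3 y.2⟩ =
      2 • (HeckeRing0.T N 2 p hp • prymDefectMap N h9 y) := by
  haveI : NeZero p := ⟨hp.ne_zero⟩
  set yV : Module.Dual ℂ (CuspForm (Gamma0 N) 2) :=
    ((y : periodHomologyHecke N) : Module.Dual ℂ (CuspForm (Gamma0 N) 2)) with hyV
  have hT : ((HeckeRing0.T N 2 p hp • (y : periodHomologyHecke N) : periodHomologyHecke N) :
      Module.Dual ℂ (CuspForm (Gamma0 N) 2)) = HeckeRing0.T N 2 p hp • yV := rfl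
  -- `t (T y) = T (t² y)` on `V`
  have htT : shiftDual N h9 (HeckeRing0.T N 2 p hp • yV) =
      HeckeRing0.T N 2 p hp • shiftDual N h9 (shiftDual N h9 yV) := by
    change shiftDual N h9 ((HeckeRing0.toEnd N 2 (HeckeRing0.T N 2 p hp)).dualMap yV) =
      (HeckeRing0.toEnd N 2 (HeckeRing0.T N 2 p hp)).dualMap (shiftDual N h9 (shiftDual N h9 yV))
    rw [HeckeRing0.toEnd_T, shiftDual_dualMap_heckeT_of_mod_three_eq_two h9 hp hp2]
  -- the `ℂ`-linearity of the Hecke action on `V`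
  have hlin : ∀ (c : ℂ) (φ ψ : Module.Dual ℂ (CuspForm (Gamma0 N) 2)),
      HeckeRing0.T N 2 p hp • (c • (φ - ψ)) = c • (HeckeRing0.T N 2 p hp • φ - HeckeRing0.T N 2 p hp • ψ) := by
    intro c φ ψ
    change (HeckeRing0.toEnd N 2 (HeckeRing0.T N 2 p hp)).dualMap (c • (φ - ψ)) =
      c • ((HeckeRing0.toEnd N 2 (HeckeRing0.T N 2 p hp)).dualMap φ -
        (HeckeRing0.toEnd N 2 (HeckeRing0.T N 2 p hp)).dualMap ψ)
    rw [map_smul, map_sub]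
  rw [prymDefectMap_apply, prymDefectMap_apply, ← Submodule.Quotient.mk_smul, ← Submodule.mkQ_apply,
    ← Submodule.mkQ_apply, ← map_nsmul, Submodule.mkQ_apply, Submodule.mkQ_apply, Submodule.Quotient.eq, hT,
    htT, hlin]
  -- difference `= T_p (t y) ∈ Λ`
  have e : (3 : ℂ)⁻¹ • (HeckeRing0.T N 2 p hp • yV - HeckeRing0.T N 2 p hp • shiftDual N h9 (shiftDual N h9 yV)) -
      2 • ((3 : ℂ)⁻¹ • (HeckeRing0.T N 2 p hp • yV - HeckeRing0.T N 2 p hp • shiftDual N h9 yV)) =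
      HeckeRing0.T N 2 p hp • shiftDual N h9 yV -
        (3 : ℂ)⁻¹ • (HeckeRing0.T N 2 p hp • normDual N h9 yV) := by
    rw [normDual_apply]
    have hadd : ∀ φ ψ : Module.Dual ℂ (CuspForm (Gamma0 N) 2),
        HeckeRing0.T N 2 p hp • (φ + ψ) = HeckeRing0.T N 2 p hp • φ + HeckeRing0.T N 2 p hp • ψ :=
      fun φ ψ ↦ smul_add _ _ _
    rw [hadd, hadd]
    generalize HeckeRing0.T N 2 p hp • yV = A
    generalize HeckeRing0.T N 2 p hp • shiftDual N h9 yV = B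
    generalize HeckeRing0.T N 2 p hp • shiftDual N h9 (shiftDual N h9 yV) = C
    module
  rw [e, normDual_coe_eq_zero N h9 y, smul_zero, smul_zero, sub_zero, ← coe_shiftInt, ← Submodule.coe_smul]
  exact Submodule.coe_mem _

/-- **`B ∩ J_tors = Nm(J_tors)`**: a torsion point of `B = Nm J₀(N)` is the norm of a TORSION point
(`x = Nm[u]`, `n x = 0` ⇒ `x = Nm[3⁻¹ Nm u]` with `3n·[3⁻¹Nm u] = [n Nm u] = 0`). [cite: DarmonDiamondTaylor1995, §1.3 (p. 32)] -/
theorem exists_mem_tors_jacobianNorm_eq {x : J0 N} (hx : x ∈ normRange N h9) (hxt : x ∈ J0.tors N) :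
    ∃ z ∈ J0.tors N, jacobianNorm N h9 z = x := by
  obtain ⟨w, rfl⟩ := hx
  obtain ⟨u, rfl⟩ := Submodule.Quotient.mk_surjective (periodHomologyHecke N) w
  rw [J0.mem_tors_iff] at hxt
  obtain ⟨n, hn, hnx⟩ := isOfFinAddOrder_iff_nsmul_eq_zero.mp hxt
  rw [jacobianNorm_mk] at hnx ⊢
  refine ⟨Submodule.Quotient.mk ((3 : ℂ)⁻¹ • normDual N h9 u), ?_, ?_⟩
  · rw [J0.mem_tors_iff, isOfFinAddOrder_iff_nsmul_eq_zero]
    refine ⟨n * 3, by omega, ?_⟩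
    have h3 : (3 : ℕ) • ((3 : ℂ)⁻¹ • normDual N h9 u) = normDual N h9 u := by
      rw [← Nat.cast_smul_eq_nsmul ℂ, smul_smul]
      norm_num
    have h3' : (3 : ℕ) • (Submodule.Quotient.mk (p := periodHomologyHecke N) ((3 : ℂ)⁻¹ • normDual N h9 u)) =
        Submodule.Quotient.mk (normDual N h9 u) := by
      rw [← Submodule.mkQ_apply, ← map_nsmul, h3, Submodule.mkQ_apply]
    rw [mul_nsmul', h3']
    exact hnx
  · rw [jacobianNorm_mk, map_smul]
    have ht : shiftDual N h9 (normDual N h9 u) = normDual N h9 u := by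
      rw [← Module.End.mul_apply, shiftDual_mul_normDual]
    have hNN : normDual N h9 (normDual N h9 u) = (3 : ℂ) • normDual N h9 u := by
      rw [normDual_apply N h9 (normDual N h9 u), ht, ht]
      module
    rw [hNN, smul_smul, inv_mul_cancel₀ (by norm_num : (3 : ℂ) ≠ 0), one_smul]

end PrymDefect

end Literature.NumberTheory.ModularSymbols

end
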